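import Mathlib
import Summits.KontsevichZagierPeriods.Zeta5Search.BrickHatLambda
import Summits.KontsevichZagierPeriods.Zeta5Search.BrickLambdaLocality
import Summits.KontsevichZagierPeriods.Zeta5Search.BrickLambdaDigit

/-!
# BrickHatMultiplier — zi-p2's THEOREM 9 LEMMA 9.2 for the OFF-DIGIT cells `K = jp + i` of the row `np`: the unit
multiplier `Λ°_K` in closed form through unit factorials (Legendre one step with HOLE digits) and its EXACT antisymmetry
`Λ°_{np−K} = −Λ°_K` (the Wilson-block digit-locality is the sequel `BrickHatLocality`; cell zeta5-irr)

HONEST FRAMING: systematic search; no irrationality claim unless certified. INSTRUMENT lemmas of the ζ(5)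
census cell zeta5-irr (HOME `run/shared/lean/pub/zeta5-irr/`; memo `zi-p2/probes/B8/thm9/THEOREM9.md` (sealed
eae326393abac726) LEMMA 9.2 «(i) Λ_K = p^A·Λ°_K with Λ°_K = ((np−2K)/2)·Ξ_K ∈ ℤ_(p)^× … Legendre one step with N = np:
C(np,K) = p·(n−j)C(n,j)·ρ₁°, C(np+K,K) = C(n+j,j)ρ₂°, C(2np−K,np) = C(2n−1−j,n)ρ₃° … (iii) Λ°_{np−K} = −Λ°_K … (iv) Each of
K*!_p/K!_p, (np−K)!_p/(np−K*)!_p, (np+K*)!_p/(np+K)!_p, (2np−K)!_p/(2np−K*)!_p is the product of the prime-to-p integers in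
t consecutive blocks of p^{e+1} consecutive integers, hence ≡ (−1)^t (mod p^{e+1}) by (W) … the signs cancel in pairs»;
THEOREM 10 LEMMA 10.2 is the same statement for every hole cell). Nothing here is about ζ(5); no irrationality content;
filing moves no rung. Filed by the engine seat zi-eng (g10); the hole-digit twin of `BrickLambdaClosedForm` /
`BrickLambdaLocality` (° cells), on `GaussWilsonBlock.unitFactorial_shift_iter` and `BrickHatStrip`/`BrickHatLambda`.

## The statements (digits subtraction-free: `i + i' = p`, `1 ≤ i, i'`; blocks `m = J + M`, `n = m + 1`; `K = i + Jp`,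
`np − K = i' + Mp`, `np + K = i + (n+J)p`, `2np − K = (i' + Mp) + np`)

* `hatMult A B p m j i = c_{K,A}(np)/(Ê_j(0)·c̃_{j,A}(m))` — THE constant `a` of `BrickHatStrip.laurentSeries_rescale_eq_hat`
  (`eq_hatMult`); `hatLam A B p m j i = hatMult/(p^A·n^{A−2B})` = zi-p2's `Λ°_K` (`Λ_K = p^AΛ°_K = a/n^{A−2B}`).
* Legendre one step for hole digits, exact in `ℕ`: `hat_choose_mul_uf` (`C(np,K)·K!_p·(np−K)!_p = p·n·C(m,J)·(np)!_p`),
  `hat_choose_add_mul_uf` (`C(np+K,K)·K!_p·(np)!_p = C(n+J,J)·(np+K)!_p`), `hat_choose_two_sub_mul_uf`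
  (`C(2np−K,np)·(np)!_p·(np−K)!_p = C(n+M,n)·(2np−K)!_p`).
* **`hatLam_mul_unitPart`** (LEMMA 9.2 (i), closed form): `Λ°_K·Û_K = ((np − 2K)/2)·Ŷ_K` with the units
  `Û_K = (K!_p(np−K)!_p)^A(K!_p(np)!_p)^B((np)!_p(np−K)!_p)^B`, `Ŷ_K = ((np)!_p)^A((np+K)!_p)^B((2np−K)!_p)^B`
  (`A` even, `p` odd: the sign is `+1`); `padicValuation_hatLam`: `v(Λ°_K) = 1`.
* **`hatLam_reflect`** (LEMMA 9.2 (iii)): `Λ°_{np−K} = −Λ°_K` (cell `i' + Mp` of block `M = m − J`).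
LEMMA 9.2 (iv) (locality) is the sequel file `BrickHatLocality`; the residue `Λ°_K ≡ −i^{1−A} (mod p)` (LEMMA 9.2 (ii))
is not needed downstream and is not typed here.
-/

namespace Summit.KontsevichZagierPeriods.Zeta5Search.BrickHatMultiplier

open Finset Nat Polynomial WithZero
open Summit.KontsevichZagierPeriods.Zeta5Search.BrickTopCoefficient (cTop cTop_reflect)
open Summit.KontsevichZagierPeriods.Zeta5Search.BrickLaurent (laurent laurent_zero)
open Summit.KontsevichZagierPeriods.Zeta5Search.BrickLambda (cTop_zero_ne_zero padicValuation_two)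
open Summit.KontsevichZagierPeriods.Zeta5Search.BrickHatStrip (hatPoly hatPoly_eval_zero_ne_zero)
open Summit.KontsevichZagierPeriods.Zeta5Search.BrickHatLambda (not_dvd_centre_hat)
open Summit.KontsevichZagierPeriods.Zeta5Search.GaussWilsonBlock (unitFactorial unitFactorial_shift_iter)
open Summit.KontsevichZagierPeriods.Zeta5Search.BrickLambdaClosedForm (factorial_eq_unitFactorial
  padicValuation_unitFactorial)
open Summit.KontsevichZagierPeriods.Zeta5Search.BrickLambdaLocality (padicValuation_sub_le_of_zmod_eq)
open Summit.KontsevichZagierPeriods.Zeta5Search.BrickResidueLawMain (cong_mul_le)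
open Summit.KontsevichZagierPeriods.Zeta5Search.BrickLambdaDigit (cTop_zero_reflect)
open Summit.KontsevichZagierPeriods.Zeta5Search.BrickLambdaCirc (padicValuation_centre_eq_one)
open Literature.NumberTheory.LFunctions (padicValuation_natCast_le_one)

variable {p : ℕ} [Fact p.Prime]

/-! ## The multiplier -/

/-- zi-p2's hat constant of the off-digit cell `K = i + jp` of the row `np` (`n = m+1`):
`hatMult = c_{K,A}(np)/(Ê_j(0)·c̃_{j,A}(m))` (`= n^{A−2B}·Λ_K`, since `n^{A−2B}Ê_j·F̃_j^{(m)} = F̂_j^{(n)}`). -/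
noncomputable def hatMult (A B p m j i : ℕ) : ℚ :=
  cTop A B 1 ((m + 1) * p) (i + j * p) / ((hatPoly B m j).eval 0 * cTop A B 0 m j)

/-- zi-p2's UNIT multiplier `Λ°_K := hatMult/(p^A·n^{A−2B})` (`Λ_K = p^A·Λ°_K`). -/
noncomputable def hatLam (A B p m j i : ℕ) : ℚ :=
  hatMult A B p m j i / ((p : ℚ) ^ A * (((m + 1 : ℕ) : ℚ)) ^ (A - 2 * B))

omit [Fact p.Prime] in
/-- `hatMult·Ê_j(0)·c̃_{j,A}(m) = c_{K,A}(np)` (`j ≤ m`). -/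
theorem hatMult_mul (A B : ℕ) {m j : ℕ} (hj : j ≤ m) (i : ℕ) :
    hatMult A B p m j i * (hatPoly B m j).eval 0 * cTop A B 0 m j = cTop A B 1 ((m + 1) * p) (i + j * p) := by
  unfold hatMult
  rw [mul_assoc, div_mul_cancel₀ _ (mul_ne_zero (hatPoly_eval_zero_ne_zero B hj) (cTop_zero_ne_zero hj A B))]

omit [Fact p.Prime] in
/-- **The constant of the hat identity is `hatMult`**: any `a` with `a·Ê_j(0)·laurent A B 0 m j 0 = laurent A B 1 (np) K 0`
(the last clause of `BrickHatStrip.laurentSeries_rescale_eq_hat`) equals `hatMult A B p m j i`. -/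
theorem eq_hatMult {A B m j i : ℕ} (hAB : 2 * B ≤ A) (hj : j ≤ m) (hK : i + j * p ≤ (m + 1) * p) {a : ℚ}
    (ha : a * (hatPoly B m j).eval 0 * laurent A B 0 m j 0 = laurent A B 1 ((m + 1) * p) (i + j * p) 0) :
    a = hatMult A B p m j i := by
  rw [laurent_zero hAB 0 hj, laurent_zero hAB 1 hK] at ha
  unfold hatMult
  rw [eq_div_iff (mul_ne_zero (hatPoly_eval_zero_ne_zero B hj) (cTop_zero_ne_zero hj A B)), ← ha, mul_assoc]

/-- `hatMult = Λ°·p^A·n^{A−2B}`. -/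
theorem hatMult_eq (A B m j i : ℕ) :
    hatMult A B p m j i = hatLam A B p m j i * ((p : ℚ) ^ A * (((m + 1 : ℕ) : ℚ)) ^ (A - 2 * B)) := by
  have hp : p.Prime := Fact.out
  unfold hatLam
  rw [div_mul_cancel₀]
  exact mul_ne_zero (pow_ne_zero _ (by exact_mod_cast hp.ne_zero)) (pow_ne_zero _ (by positivity))

/-! ## Legendre one step for hole digits, exactly -/

section legendre

variable {i i' : ℕ} (hii : i + i' = p) (hi : 1 ≤ i) (hi' : 1 ≤ i') (J M : ℕ)
include hii hi hi'

/-- `C(np,K)·K!_p·(np−K)!_p = p·n·C(m,J)·(np)!_p` (`n = J+M+1`, `K = i + Jp`, `np − K = i' + Mp`). -/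
theorem hat_choose_mul_uf :
    ((J + M + 1) * p).choose (i + J * p) * unitFactorial p (i + J * p) * unitFactorial p (i' + M * p) =
      p * (J + M + 1) * (J + M).choose J * unitFactorial p ((J + M + 1) * p) := by
  have hp : p.Prime := Fact.out
  have e0 : i' + M * p + (i + J * p) = (J + M + 1) * p := by
    calc i' + M * p + (i + J * p) = (i + i') + (J + M) * p := by ring
      _ = _ := by rw [hii]; ring
  have h1 := Nat.add_choose_mul_factorial_mul_factorial (i' + M * p) (i + J * p)
  rw [e0] at h1
  have hK := factorial_eq_unitFactorial (p := p) (i + J * p)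
  have hK' := factorial_eq_unitFactorial (p := p) (i' + M * p)
  have hN := factorial_eq_unitFactorial (p := p) ((J + M + 1) * p)
  rw [Nat.add_mul_div_right _ _ hp.pos, Nat.div_eq_of_lt (by omega), zero_add] at hK hK'
  rw [Nat.mul_div_cancel _ hp.pos] at hN
  have h2 := Nat.add_choose_mul_factorial_mul_factorial M J
  rw [add_comm M J] at h2
  have hp0 : 0 < p := hp.pos
  have hD : 0 < p ^ (J + M) * J ! * M ! := by positivity
  refine Nat.eq_of_mul_eq_mul_right hD ?_
  calc _ = ((J + M + 1) * p).choose (i + J * p) * (p ^ M * M ! * unitFactorial p (i' + M * p)) *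
        (p ^ J * J ! * unitFactorial p (i + J * p)) := by rw [pow_add]; ring
    _ = ((J + M + 1) * p)! := by rw [← hK', ← hK, ← h1]
    _ = _ := by rw [hN, pow_succ, Nat.factorial_succ, ← h2]; ring

omit hi in
/-- `C(np+K,K)·K!_p·(np)!_p = C(n+J,J)·(np+K)!_p` (`np + K = i + (n+J)p`). -/
theorem hat_choose_add_mul_uf :
    ((J + M + 1) * p + (i + J * p)).choose (i + J * p) * unitFactorial p (i + J * p) *
        unitFactorial p ((J + M + 1) * p) =
      (J + M + 1 + J).choose J * unitFactorial p ((J + M + 1) * p + (i + J * p)) := by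
  have hp : p.Prime := Fact.out
  have h1 := Nat.add_choose_mul_factorial_mul_factorial ((J + M + 1) * p) (i + J * p)
  have hK := factorial_eq_unitFactorial (p := p) (i + J * p)
  have hN := factorial_eq_unitFactorial (p := p) ((J + M + 1) * p)
  have hS := factorial_eq_unitFactorial (p := p) ((J + M + 1) * p + (i + J * p))
  rw [Nat.add_mul_div_right _ _ hp.pos, Nat.div_eq_of_lt (by omega), zero_add] at hK
  rw [Nat.mul_div_cancel _ hp.pos] at hN
  have e0 : (J + M + 1) * p + (i + J * p) = i + (J + M + 1 + J) * p := by ring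
  rw [e0, Nat.add_mul_div_right _ _ hp.pos, Nat.div_eq_of_lt (by omega), zero_add, ← e0] at hS
  have h2 := Nat.add_choose_mul_factorial_mul_factorial (J + M + 1) J
  have hp0 : 0 < p := hp.pos
  have hD : 0 < p ^ (J + M + 1 + J) * (J + M + 1)! * J ! := by positivity
  refine Nat.eq_of_mul_eq_mul_right hD ?_
  calc _ = ((J + M + 1) * p + (i + J * p)).choose (i + J * p) *
        (p ^ (J + M + 1) * (J + M + 1)! * unitFactorial p ((J + M + 1) * p)) *
        (p ^ J * J ! * unitFactorial p (i + J * p)) := by rw [pow_add]; ring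
    _ = ((J + M + 1) * p + (i + J * p))! := by rw [← hK, ← hN, ← h1]
    _ = _ := by rw [hS, ← h2]; ring

omit hi' in
/-- `C(2np−K,np)·(np)!_p·(np−K)!_p = C(n+M,n)·(2np−K)!_p` (`2np − K = (i' + Mp) + np`, `n + M = 2n−1−J`). -/
theorem hat_choose_two_sub_mul_uf :
    (i' + M * p + (J + M + 1) * p).choose ((J + M + 1) * p) * unitFactorial p ((J + M + 1) * p) *
        unitFactorial p (i' + M * p) =
      (M + (J + M + 1)).choose (J + M + 1) * unitFactorial p (i' + M * p + (J + M + 1) * p) := by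
  have hp : p.Prime := Fact.out
  have h1 := Nat.add_choose_mul_factorial_mul_factorial (i' + M * p) ((J + M + 1) * p)
  have hK' := factorial_eq_unitFactorial (p := p) (i' + M * p)
  have hN := factorial_eq_unitFactorial (p := p) ((J + M + 1) * p)
  have hS := factorial_eq_unitFactorial (p := p) (i' + M * p + (J + M + 1) * p)
  rw [Nat.add_mul_div_right _ _ hp.pos, Nat.div_eq_of_lt (by omega), zero_add] at hK'
  rw [Nat.mul_div_cancel _ hp.pos] at hN
  have e0 : i' + M * p + (J + M + 1) * p = i' + (M + (J + M + 1)) * p := by ring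
  rw [e0, Nat.add_mul_div_right _ _ hp.pos, Nat.div_eq_of_lt (by omega), zero_add, ← e0] at hS
  have h2 := Nat.add_choose_mul_factorial_mul_factorial M (J + M + 1)
  have hp0 : 0 < p := hp.pos
  have hD : 0 < p ^ (M + (J + M + 1)) * M ! * (J + M + 1)! := by positivity
  refine Nat.eq_of_mul_eq_mul_right hD ?_
  calc _ = (i' + M * p + (J + M + 1) * p).choose ((J + M + 1) * p) *
        (p ^ M * M ! * unitFactorial p (i' + M * p)) *
        (p ^ (J + M + 1) * (J + M + 1)! * unitFactorial p ((J + M + 1) * p)) := by rw [pow_add]; ring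
    _ = (i' + M * p + (J + M + 1) * p)! := by rw [← hK', ← hN, ← h1]
    _ = _ := by rw [hS, ← h2]; ring

end legendre

/-! ## LEMMA 9.2 (i): the closed form `Λ°_K·Û_K = ((np−2K)/2)·Ŷ_K` -/

/-- The UNIT PART `Û_K = (K!_p(np−K)!_p)^A·(K!_p(np)!_p)^B·((np)!_p(np−K)!_p)^B ∈ ℕ` (denominators of
`ρ₁°^Aρ₂°^Bρ₃°^B`) of the off-digit cell with digits `i + i' = p`, blocks `J + M = m`. -/
def hatUnitPart (p A B i i' J M : ℕ) : ℕ :=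
  (unitFactorial p (i + J * p) * unitFactorial p (i' + M * p)) ^ A *
    (unitFactorial p (i + J * p) * unitFactorial p ((J + M + 1) * p)) ^ B *
    (unitFactorial p ((J + M + 1) * p) * unitFactorial p (i' + M * p)) ^ B

/-- The GAINED PART `Ŷ_K = ((np)!_p)^A·((np+K)!_p)^B·((2np−K)!_p)^B ∈ ℕ` (numerators of `ρ₁°^Aρ₂°^Bρ₃°^B`). -/
def hatGainPart (p A B i i' J M : ℕ) : ℕ :=
  unitFactorial p ((J + M + 1) * p) ^ A * unitFactorial p ((J + M + 1) * p + (i + J * p)) ^ B *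
    unitFactorial p (i' + M * p + (J + M + 1) * p) ^ B

/-- `Û_K` is a `p`-adic unit. -/
theorem padicValuation_hatUnitPart (A B i i' J M : ℕ) :
    Rat.padicValuation p (hatUnitPart p A B i i' J M : ℚ) = 1 := by
  unfold hatUnitPart
  push_cast
  simp only [map_mul, map_pow, padicValuation_unitFactorial, one_pow, mul_one]

/-- `Ŷ_K` is a `p`-adic unit. -/
theorem padicValuation_hatGainPart (A B i i' J M : ℕ) :
    Rat.padicValuation p (hatGainPart p A B i i' J M : ℚ) = 1 := by
  unfold hatGainPart
  push_cast
  simp only [map_mul, map_pow, padicValuation_unitFactorial, one_pow, mul_one]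

section closed

variable (hp2 : p ≠ 2) {A B i i' J M : ℕ} (hA : Even A) (hAB : 2 * B ≤ A) (hii : i + i' = p) (hi : 1 ≤ i)
  (hi' : 1 ≤ i')
include hii hi hi'

/-- `c_{K,A}(np)·Û_K = (−1)^{npB+KA}·((np)/2 − K)·(p·n·C(m,J))^A·(C(n+J,J)·C(n+M,n))^B·Ŷ_K`. -/
theorem cTop_mul_hatUnitPart :
    cTop A B 1 ((J + M + 1) * p) (i + J * p) * (hatUnitPart p A B i i' J M : ℚ) =
      (-1) ^ ((J + M + 1) * p * B + (i + J * p) * A) *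
        ((((J + M + 1) * p : ℕ) : ℚ) / 2 - ((i + J * p : ℕ) : ℚ)) *
        (((p : ℚ) * ((J + M + 1 : ℕ) : ℚ) * (((J + M).choose J : ℕ) : ℚ)) ^ A *
          ((((J + M + 1 + J).choose J : ℕ) : ℚ) * (((M + (J + M + 1)).choose (J + M + 1) : ℕ) : ℚ)) ^ B) *
        (hatGainPart p A B i i' J M : ℚ) := by
  have hρ1 : ((((J + M + 1) * p).choose (i + J * p) : ℕ) : ℚ) * (unitFactorial p (i + J * p) : ℚ) *
      (unitFactorial p (i' + M * p) : ℚ) =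
      (p : ℚ) * ((J + M + 1 : ℕ) : ℚ) * (((J + M).choose J : ℕ) : ℚ) * (unitFactorial p ((J + M + 1) * p) : ℚ) := by
    exact_mod_cast hat_choose_mul_uf hii hi hi' J M
  have hρ2 : ((((J + M + 1) * p + (i + J * p)).choose (i + J * p) : ℕ) : ℚ) * (unitFactorial p (i + J * p) : ℚ) *
      (unitFactorial p ((J + M + 1) * p) : ℚ) =
      (((J + M + 1 + J).choose J : ℕ) : ℚ) * (unitFactorial p ((J + M + 1) * p + (i + J * p)) : ℚ) := by
    exact_mod_cast hat_choose_add_mul_uf hii hi' J M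
  have hρ3 : (((i' + M * p + (J + M + 1) * p).choose ((J + M + 1) * p) : ℕ) : ℚ) *
      (unitFactorial p ((J + M + 1) * p) : ℚ) * (unitFactorial p (i' + M * p) : ℚ) =
      (((M + (J + M + 1)).choose (J + M + 1) : ℕ) : ℚ) * (unitFactorial p (i' + M * p + (J + M + 1) * p) : ℚ) := by
    exact_mod_cast hat_choose_two_sub_mul_uf hii hi J M
  have e2 : 2 * ((J + M + 1) * p) - (i + J * p) = i' + M * p + (J + M + 1) * p := by
    have : 2 * ((J + M + 1) * p) = (i + J * p) + (i' + M * p + (J + M + 1) * p) := by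
      calc 2 * ((J + M + 1) * p) = (i + i') + (J + M) * p + (J + M + 1) * p := by rw [hii]; ring
        _ = _ := by ring
    omega
  unfold cTop hatUnitPart hatGainPart
  rw [e2, pow_one]
  simp only [Nat.cast_mul, Nat.cast_pow]
  calc _ = (-1) ^ ((J + M + 1) * p * B + (i + J * p) * A) *
        (((J + M + 1 : ℕ) : ℚ) * (p : ℚ) / 2 - ((i + J * p : ℕ) : ℚ)) *
        (((((J + M + 1) * p).choose (i + J * p) : ℕ) : ℚ) * (unitFactorial p (i + J * p) : ℚ) *
          (unitFactorial p (i' + M * p) : ℚ)) ^ A *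
        ((((((J + M + 1) * p + (i + J * p)).choose (i + J * p) : ℕ) : ℚ) * (unitFactorial p (i + J * p) : ℚ) *
          (unitFactorial p ((J + M + 1) * p) : ℚ)) *
          ((((i' + M * p + (J + M + 1) * p).choose ((J + M + 1) * p) : ℕ) : ℚ) *
          (unitFactorial p ((J + M + 1) * p) : ℚ) * (unitFactorial p (i' + M * p) : ℚ))) ^ B := by ring
    _ = _ := by rw [hρ1, hρ2, hρ3]; ring

omit hii hi hi' in
/-- `Ê_J(0)·c̃_{J,A}(m) = (−1)^{nB+JA}·n^{2B}·C(m,J)^A·(C(n+J,J)·C(n+M,n))^B` (`m = J + M`, `n = m+1`). -/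
theorem hatPoly_mul_cTop_zero :
    (hatPoly B (J + M) J).eval 0 * cTop A B 0 (J + M) J =
      (-1) ^ ((J + M + 1) * B + J * A) * (((J + M + 1 : ℕ) : ℚ)) ^ (2 * B) *
        ((((J + M).choose J : ℕ) : ℚ) ^ A *
          ((((J + M + 1 + J).choose J : ℕ) : ℚ) * (((M + (J + M + 1)).choose (J + M + 1) : ℕ) : ℚ)) ^ B) := by
  have h2n := Nat.choose_mul_succ_eq (J + M + J) J
  rw [show J + M + J + 1 - J = J + M + 1 by omega, show J + M + J + 1 = J + M + 1 + J by ring] at h2n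
  have h2 : (((J + M + J).choose J : ℕ) : ℚ) * ((J + M + 1 + J : ℕ) : ℚ) =
      (((J + M + 1 + J).choose J : ℕ) : ℚ) * ((J + M + 1 : ℕ) : ℚ) := by exact_mod_cast h2n
  have h3n := Nat.add_one_mul_choose_eq (M + (J + M)) (J + M)
  rw [show M + (J + M) + 1 = M + (J + M + 1) by ring] at h3n
  have h3 : ((M + (J + M + 1) : ℕ) : ℚ) * (((M + (J + M)).choose (J + M) : ℕ) : ℚ) =
      (((M + (J + M + 1)).choose (J + M + 1) : ℕ) : ℚ) * ((J + M + 1 : ℕ) : ℚ) := by exact_mod_cast h3n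
  have hb : (((J + M + J).choose J : ℕ) : ℚ) * (((M + (J + M)).choose (J + M) : ℕ) : ℚ) *
      (((J + M + 1 + J : ℕ) : ℚ) * ((M + (J + M + 1) : ℕ) : ℚ)) =
      ((J + M + 1 : ℕ) : ℚ) ^ 2 *
        ((((J + M + 1 + J).choose J : ℕ) : ℚ) * (((M + (J + M + 1)).choose (J + M + 1) : ℕ) : ℚ)) := by
    linear_combination ((((M + (J + M)).choose (J + M) : ℕ) : ℚ) * ((M + (J + M + 1) : ℕ) : ℚ)) * h2 +
      ((((J + M + 1 + J).choose J : ℕ) : ℚ) * ((J + M + 1 : ℕ) : ℚ)) * h3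
  have hE : (hatPoly B (J + M) J).eval 0 =
      (-(((J + M + 1 + J : ℕ) : ℚ))) ^ B * (((M + (J + M + 1) : ℕ) : ℚ)) ^ B := by
    unfold hatPoly
    simp only [eval_mul, eval_pow, eval_add, eval_X, eval_C, zero_add]
    congr 2
    · push_cast; ring
    · push_cast; ring
  have key : (-(((J + M + 1 + J : ℕ) : ℚ))) ^ B * (((M + (J + M + 1) : ℕ) : ℚ)) ^ B *
      ((((J + M + J).choose J : ℕ) : ℚ) * (((M + (J + M)).choose (J + M) : ℕ) : ℚ)) ^ B =
      (-1) ^ B * ((J + M + 1 : ℕ) : ℚ) ^ (2 * B) *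
        ((((J + M + 1 + J).choose J : ℕ) : ℚ) * (((M + (J + M + 1)).choose (J + M + 1) : ℕ) : ℚ)) ^ B := by
    calc _ = ((-(((J + M + 1 + J : ℕ) : ℚ))) * (((M + (J + M + 1) : ℕ) : ℚ)) *
          ((((J + M + J).choose J : ℕ) : ℚ) * (((M + (J + M)).choose (J + M) : ℕ) : ℚ))) ^ B := by
          rw [← mul_pow, ← mul_pow]
      _ = ((-1) * (((J + M + 1 : ℕ) : ℚ) ^ 2 *
          ((((J + M + 1 + J).choose J : ℕ) : ℚ) * (((M + (J + M + 1)).choose (J + M + 1) : ℕ) : ℚ)))) ^ B := by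
          congr 1; linear_combination (-1 : ℚ) * hb
      _ = _ := by rw [mul_pow, mul_pow, ← pow_mul, mul_assoc]
  rw [hE]
  unfold cTop
  rw [pow_zero, mul_one, show 2 * (J + M) - J = M + (J + M) by omega,
    show (J + M + 1) * B + J * A = ((J + M) * B + J * A) + B by ring, pow_add]
  linear_combination ((-1 : ℚ) ^ ((J + M) * B + J * A) * (((J + M).choose J : ℕ) : ℚ) ^ A) * key

include hp2 hA hAB in
/-- **LEMMA 9.2 (i), closed form**: `Λ°_K·Û_K = ((np)/2 − K)·Ŷ_K` for the off-digit cell `K = i + Jp` of the row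
`np`, `n = J + M + 1` (`A` even, `p` odd, `2B ≤ A`: the sign `(−1)^{(np+n)B}` is `+1`). -/
theorem hatLam_mul_unitPart :
    hatLam A B p (J + M) J i * (hatUnitPart p A B i i' J M : ℚ) =
      ((((J + M + 1) * p : ℕ) : ℚ) / 2 - ((i + J * p : ℕ) : ℚ)) * (hatGainPart p A B i i' J M : ℚ) := by
  have hp : p.Prime := Fact.out
  have hpQ : (p : ℚ) ≠ 0 := by exact_mod_cast hp.ne_zero
  have hnQ : (((J + M + 1 : ℕ) : ℚ)) ≠ 0 := by positivity
  have hmul := hatMult_mul (p := p) A B (Nat.le_add_right J M) i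
  rw [hatMult_eq, mul_assoc, hatPoly_mul_cTop_zero] at hmul
  have key := cTop_mul_hatUnitPart (p := p) (A := A) (B := B) (J := J) (M := M) hii hi hi'
  -- the nonzero binomial block and the normalising powers
  have hT0 : (((J + M).choose J : ℕ) : ℚ) ^ A *
      ((((J + M + 1 + J).choose J : ℕ) : ℚ) * (((M + (J + M + 1)).choose (J + M + 1) : ℕ) : ℚ)) ^ B ≠ 0 := by
    have h1 : 0 < (J + M).choose J := Nat.choose_pos (Nat.le_add_right J M)
    have h2 : 0 < (J + M + 1 + J).choose J := Nat.choose_pos (by omega)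
    have h3 : 0 < (M + (J + M + 1)).choose (J + M + 1) := Nat.choose_pos (Nat.le_add_left _ _)
    positivity
  have hD : (p : ℚ) ^ A * (((J + M + 1 : ℕ) : ℚ)) ^ A * ((((J + M).choose J : ℕ) : ℚ) ^ A *
      ((((J + M + 1 + J).choose J : ℕ) : ℚ) * (((M + (J + M + 1)).choose (J + M + 1) : ℕ) : ℚ)) ^ B) ≠ 0 :=
    mul_ne_zero (mul_ne_zero (pow_ne_zero _ hpQ) (pow_ne_zero _ hnQ)) hT0
  have hP : (p : ℚ) ^ A * (((J + M + 1 : ℕ) : ℚ)) ^ (A - 2 * B) * (((J + M + 1 : ℕ) : ℚ)) ^ (2 * B) =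
      (p : ℚ) ^ A * (((J + M + 1 : ℕ) : ℚ)) ^ A := by
    rw [mul_assoc, ← pow_add, Nat.sub_add_cancel hAB]
  -- signs: `A` even; `np + n = n(p+1)` even
  have hsA : ∀ x : ℕ, ((-1 : ℚ)) ^ (x * A) = 1 := fun x => (hA.mul_left x).neg_one_pow
  have hev : Even ((J + M + 1) * B + (J + M + 1) * p * B) := by
    rw [show (J + M + 1) * B + (J + M + 1) * p * B = ((J + M + 1) * B) * (p + 1) by ring]
    exact ((hp.odd_of_ne_two hp2).add_one).mul_left _
  have hss : ((-1 : ℚ)) ^ ((J + M + 1) * B + J * A) * (-1) ^ ((J + M + 1) * p * B + (i + J * p) * A) = 1 := by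
    rw [pow_add, pow_add, hsA, hsA, mul_one, mul_one, ← pow_add, hev.neg_one_pow]
  have hs00 : ((-1 : ℚ)) ^ ((J + M + 1) * B + J * A) * (-1) ^ ((J + M + 1) * B + J * A) = 1 := by
    rw [← pow_add, ← two_mul, pow_mul, neg_one_sq, one_pow]
  -- the main cancellation
  have h1 : hatLam A B p (J + M) J i * (hatUnitPart p A B i i' J M : ℚ) * (-1) ^ ((J + M + 1) * B + J * A) *
      ((p : ℚ) ^ A * (((J + M + 1 : ℕ) : ℚ)) ^ A * ((((J + M).choose J : ℕ) : ℚ) ^ A *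
        ((((J + M + 1 + J).choose J : ℕ) : ℚ) * (((M + (J + M + 1)).choose (J + M + 1) : ℕ) : ℚ)) ^ B)) =
      ((((J + M + 1) * p : ℕ) : ℚ) / 2 - ((i + J * p : ℕ) : ℚ)) * (hatGainPart p A B i i' J M : ℚ) *
        (-1) ^ ((J + M + 1) * p * B + (i + J * p) * A) *
      ((p : ℚ) ^ A * (((J + M + 1 : ℕ) : ℚ)) ^ A * ((((J + M).choose J : ℕ) : ℚ) ^ A *
        ((((J + M + 1 + J).choose J : ℕ) : ℚ) * (((M + (J + M + 1)).choose (J + M + 1) : ℕ) : ℚ)) ^ B)) := by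
    calc _ = hatLam A B p (J + M) J i * ((p : ℚ) ^ A * (((J + M + 1 : ℕ) : ℚ)) ^ (A - 2 * B)) *
          ((-1) ^ ((J + M + 1) * B + J * A) * (((J + M + 1 : ℕ) : ℚ)) ^ (2 * B) *
            ((((J + M).choose J : ℕ) : ℚ) ^ A *
              ((((J + M + 1 + J).choose J : ℕ) : ℚ) * (((M + (J + M + 1)).choose (J + M + 1) : ℕ) : ℚ)) ^ B)) *
          (hatUnitPart p A B i i' J M : ℚ) := by rw [← hP]; ring
      _ = cTop A B 1 ((J + M + 1) * p) (i + J * p) * (hatUnitPart p A B i i' J M : ℚ) := by rw [hmul]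
      _ = _ := by rw [key]; ring
  have h2 := mul_right_cancel₀ hD h1
  calc _ = hatLam A B p (J + M) J i * (hatUnitPart p A B i i' J M : ℚ) *
        (((-1 : ℚ)) ^ ((J + M + 1) * B + J * A) * (-1) ^ ((J + M + 1) * B + J * A)) := by rw [hs00, mul_one]
    _ = hatLam A B p (J + M) J i * (hatUnitPart p A B i i' J M : ℚ) * (-1) ^ ((J + M + 1) * B + J * A) *
        (-1) ^ ((J + M + 1) * B + J * A) := by ring
    _ = ((((J + M + 1) * p : ℕ) : ℚ) / 2 - ((i + J * p : ℕ) : ℚ)) * (hatGainPart p A B i i' J M : ℚ) *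
        (((-1 : ℚ)) ^ ((J + M + 1) * B + J * A) * (-1) ^ ((J + M + 1) * p * B + (i + J * p) * A)) := by
        rw [h2]; ring
    _ = _ := by rw [hss, mul_one]

include hp2 hA hAB in
/-- **`Λ°_K` is a `p`-adic unit**: `v(Λ°_K) = 1` (the centre `(np − 2K)/2` is prime to `p` since `p ∤ 2i`). -/
theorem padicValuation_hatLam : Rat.padicValuation p (hatLam A B p (J + M) J i) = 1 := by
  have hU := padicValuation_hatUnitPart (p := p) A B i i' J M
  have hY := padicValuation_hatGainPart (p := p) A B i i' J M
  have h := congrArg (Rat.padicValuation p) (hatLam_mul_unitPart hp2 hA hAB hii hi hi' (J := J) (M := M))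
  rw [map_mul, map_mul, hU, hY, mul_one, mul_one] at h
  rw [h]
  exact padicValuation_centre_eq_one hp2 (not_dvd_centre_hat (m := J + M) (j := J) hi (by omega) hp2)

end closed

/-! ## LEMMA 9.2 (iii): exact antisymmetry -/

/-- `Ê_{m−J}(0) = Ê_J(0)` (`m = J + M`: the two roots `−(J+n)`, `n+M` are exchanged up to sign, `B` of each). -/
theorem hatPoly_eval_zero_reflect (B J M : ℕ) :
    (hatPoly B (J + M) M).eval 0 = (hatPoly B (J + M) J).eval 0 := by
  unfold hatPoly
  simp only [eval_mul, eval_pow, eval_add, eval_X, eval_C, zero_add]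
  rw [← mul_pow, ← mul_pow]
  congr 1
  push_cast
  ring

omit [Fact p.Prime] in
/-- **LEMMA 9.2 (iii)**: `Λ°_{np−K} = −Λ°_K` — the reflected cell `np − K = i' + Mp` lies in block `M = m − J` with
digit `i' = p − i` (`A` even; `c_{np−K,A}(np) = −c_{K,A}(np)`, `ĉ_{m−J,A} = ĉ_{J,A}`). -/
theorem hatLam_reflect {A : ℕ} (hA : Even A) (B : ℕ) {i i' : ℕ} (hii : i + i' = p) (J M : ℕ) :
    hatLam A B p (J + M) M i' = -hatLam A B p (J + M) J i := by
  have hK : i + J * p ≤ (J + M + 1) * p := by nlinarith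
  have e : i' + M * p = (J + M + 1) * p - (i + J * p) := by
    have : (J + M + 1) * p = (i + J * p) + (i' + M * p) := by
      calc (J + M + 1) * p = (i + i') + (J + M) * p := by rw [hii]; ring
        _ = _ := by ring
    omega
  have hc0 : cTop A B 0 (J + M) (J + M - J) = cTop A B 0 (J + M) J := cTop_zero_reflect hA B (Nat.le_add_right J M)
  rw [Nat.add_sub_cancel_left] at hc0
  unfold hatLam hatMult
  rw [e, cTop_reflect hA B hK, hc0, hatPoly_eval_zero_reflect, neg_div, neg_div]

end Summit.KontsevichZagierPeriods.Zeta5Search.BrickHatMultiplier
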